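/-
COR-CM (cell pub-hodgecm2) — THE HECKE ALGEBRA ON `H¹(X_Γ(ℂ); ℚ)` OF THE REALISING PICARD MODULAR SURFACES: the transpose of
`T_γ` IS `T_{γ⁻¹}`, and for every inverse-closed set `S` of rational isometries whose Hecke operators pairwise COMMUTE,
EVERY element of `ℚ[T_γ : γ ∈ S]` is a SEMISIMPLE endomorphism — with the invariant Kähler class (ℓ) and the
transpose-closure (t) DISCHARGED in the kernel; the one displayed hypothesis is (c) commutativity (printed for the spherical
Hecke algebra, Shimura 1971 §3).  Lane «L-BYPASS LEAVES» (b10 gen 22): kernel text by the seat pub-hodgecm2-s2crux-idea-2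
(probes RA-v32 Part J, RA-v33 Part K, gens 8–9; the (ℓ)-free packaging by b10 over p319488); filed by b10.  Count-neutral: no
BINDER-OWNERS row, nothing under `B01/Transposition`, Interfaces (C1) / E term untouched.  HC_CM is NOT proved; B01-S is NOT
discharged; this file inhabits no binder of the END display; it is the (M1) → «Hecke algebra semisimple» segment of ONE
hedge derivation of B01-S (the Hecke–Hodge dictionary line), whose remaining displayed inputs are printed one-sentence facts.
-/
import Summits.HodgeConjecture.CorCM.Geometry.HeckeOperatorSemisimple
import Literature.AlgebraicGeometry.Motives.HodgeStructurePolarizationAdjoinSemisimple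
import Literature.AlgebraicTopology.SingularHomology.FiniteCoverTransferSwap
import HarnessLib

set_option autoImplicit false

/-!
# The Hecke algebra on `H¹(X_Γ(ℂ); ℚ)`: `ᵗT_γ = T_{γ⁻¹}`, and commutative Hecke algebras are semisimple

`X_Γ = Var.scheme hU h₃ (.pms (pmsCode L ι₁ V Γ))` (torsion-free level `Γ` of an anisotropic hermitian `3`-space `V` over the
CM field `L`); for `γ ∈ U(V)(L)` the Hecke pair `(f₁, g) : X_{Γ ∩ γ⁻¹Γγ} ⇉ X_Γ`, `T_γ = τ'_{f₁} ∘ g^*`, `ᵗT_γ = τ'_g ∘ f₁^*`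
(`HeckeOperatorSemisimple`).

* §1 `Level.map_conj_heckePair_Γ_le_heckePair_inv` — `γ (Γ ∩ γ⁻¹Γγ) γ⁻¹ ≤ Γ ∩ γΓγ⁻¹`: the Hecke translation `[v] ↦ [γ v]`
  maps the Hecke level of `γ` to the Hecke level of `γ⁻¹`.
* §2 `Model.transferMap_comp_pull_eq_of_heckePair_inv` — **`ᵗT_γ = T_{γ⁻¹}`**: for Hecke pairs `(f₁, g)` over `Γ_γ` and
  `(f₁', g')` over `Γ_{γ⁻¹}`, `τ'_g ∘ f₁^* = τ'_{f₁'} ∘ g'^*` on `Hⁿ(X_Γ(ℂ); ℚ)` — the Hecke translation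
  `φ : X_{Γ_γ} → X_{Γ_{γ⁻¹}}` satisfies `g = f₁' ∘ φ`, `f₁ = g' ∘ φ` on complex points, and `τ'_{f₁'∘φ} ∘ (g'∘φ)^* = τ'_{f₁'} ∘ g'^*`
  (`FiniteCoverTransferSwap`); the geometric form of `ᵗ(ΓγΓ) = Γγ⁻¹Γ`.
* §3 `Model.exists_heckeAlgebra_isSemisimple_of_inv_mem` — there are families `T, ᵗT : U(V)(L) → End_ℚ H¹(X_Γ(ℂ); ℚ)` of Hecke
  operators and transposes built from the Hecke pairs (finite coverings), with every `T_γ` a HODGE endomorphism, a non-zero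
  rational multiple of `ᵗT_γ` the `Q`-adjoint of `T_γ` for the polarisation of record (`Q = Q_η`, `η` the cover-stable
  Kähler–rational class of `HeckeInvariantKaehlerDatum` — (ℓ) DISCHARGED), `ᵗT_γ = T_{γ⁻¹}` ((t) DISCHARGED, §2), and:
  **for every `S ⊆ U(V)(L)` closed under `γ ↦ γ⁻¹` whose operators pairwise commute, every element of `ℚ[T_γ : γ ∈ S]` is
  semisimple** (`Polarization.isSemisimple_of_mem_adjoin`, `HodgeStructurePolarizationAdjoinSemisimple`).  This is the input
  `hss` of the CM-type criterion `CMTypeOfSemisimpleRationalActionFamily` for the Hecke algebra; displayed: (c) only.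

References: G. Shimura, *Introduction to the Arithmetic Theory of Automorphic Functions* (1971), §3.1 Prop. 3.1, §3.2–3.4
((3.4.5): `ᵗ(ΓγΓ) = Γγ⁻¹Γ`; commutativity of the Hecke ring), §7.2–7.3 [Shimura1971]; N. Bergeron, J. Millson, C. Moeglin,
Acta Math. 216 (2016), Part 2 §1.3, §1.8 [BergeronMillsonMoeglin2016Balls]; A. Hatcher, *Algebraic Topology* (2002), §3.G
[HatcherAT2002]; H. Lange, *Abelian Varieties over the Complex Numbers* (2023), §2.4.1 Thm. 2.4.9 [Lange2023AbelianVarietiesC];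
C. Voisin, *Hodge Theory and Complex Algebraic Geometry I* (2002), §7.1.2 [VoisinHodgeI2002].
-/

noncomputable section

open CategoryTheory Matrix
open Literature.AlgebraicGeometry.Motives (SchemeOver ComplexPoints AlgPoints bettiCohomology)
open Literature.AlgebraicGeometry.HodgeTheory
open Literature.AlgebraicGeometry.ShimuraVarieties
open Literature.AlgebraicTopology.SingularHomology

namespace Summit.HodgeConjecture.CorCM

open NumberField Literature.NumberTheory.Automorphic

/-! ## §1 The Hecke level of `γ` is carried into the Hecke level of `γ⁻¹` -/

namespace Level

variable {L : CMField} {ι₁ : L →+* ℂ} {V : HermSpace3 L ι₁}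
variable (Γ : Level V) {γ : GL (Fin 3) L} (hγ : γ ∈ unitaryGroup (cmConjRingHom L) V.Hm)

/-- **`γ (Γ ∩ γ⁻¹Γγ) γ⁻¹ ≤ Γ ∩ γΓγ⁻¹`** — the Hecke level of `γ` is carried by `γ` INTO the Hecke level of
`γ⁻¹` (in fact onto), the hypothesis of the Hecke translation `X_{Γ_γ} → X_{Γ_{γ⁻¹}}`, `[v] ↦ [γ v]`.
[cite: Shimura1971, §3.1 Prop. 3.1 and §7.2–7.3] -/
theorem map_conj_heckePair_Γ_le_heckePair_inv :
    (Γ.heckePair γ hγ).Γ.map (MulAut.conj γ).toMonoidHom ≤ (Γ.heckePair γ⁻¹ (inv_mem hγ)).Γ := by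
  rintro _ ⟨δ, hδ, rfl⟩
  refine Subgroup.mem_inf.mpr ⟨?_, ?_⟩
  · simpa [MulAut.conj_apply] using Γ.conj_mem_of_mem_heckePair hγ hδ
  · rw [inv_inv]
    exact Subgroup.mem_map_of_mem _ (Subgroup.mem_inf.mp hδ).1

end Level

/-! ## §2 The transpose of `T_γ` is `T_{γ⁻¹}` -/

namespace Model

open NumberField
open Literature.NumberTheory.Automorphic
open Literature.NumberTheory.Automorphic.PicardCM

section TransposeSwap

variable {hU : BallQuotientUniformisedDatum} {h₃ : CMAbelianVarietyRealised}
variable {L : CMField} {ι₁ : L →+* ℂ} {V : HermSpace3 L ι₁}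

/-- `γ⁻¹ (γ v) = v` after `ι₁`. [folklore] -/
theorem map_inv_mulVec_map_mulVec (γ : GL (Fin 3) L) (v : Fin 3 → ℂ) :
    (((γ⁻¹ : GL (Fin 3) L) : Matrix (Fin 3) (Fin 3) L).map ι₁) *ᵥ
        ((((γ : Matrix (Fin 3) (Fin 3) L).map ι₁)) *ᵥ v) = v := by
  rw [Matrix.mulVec_mulVec, ← Matrix.map_mul, ← Units.val_mul, inv_mul_cancel, Units.val_one,
    Matrix.map_one ι₁ (map_zero ι₁) (map_one ι₁), Matrix.one_mulVec]

/-- `U(V,h)(L)` preserves the negative cone of every realising level (same Gram matrix `H^{ι₁}`).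
[cite: BergeronMillsonMoeglin2016Balls, Part 2 §1.3] -/
theorem map_mulVec_mem_cone {Γ₁ Γ₂ : Level V} (h₁ : (pmsCode L ι₁ V Γ₁).IsAnisotropic)
    (h₂ : (pmsCode L ι₁ V Γ₂).IsAnisotropic) {γ : GL (Fin 3) L} (hγ : γ ∈ unitaryGroup (cmConjRingHom L) V.Hm)
    {v : Fin 3 → ℂ} (hv : v ∈ (Var.ballDatum hU h₃ (pmsCode L ι₁ V Γ₁) h₁).cone) :
    ((γ : Matrix (Fin 3) (Fin 3) L).map ι₁) *ᵥ v ∈ (Var.ballDatum hU h₃ (pmsCode L ι₁ V Γ₂) h₂).cone := by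
  change _ ∈ negCone (Var.ballDatum hU h₃ (pmsCode L ι₁ V Γ₂) h₂).Hℂ
  rw [← ballDatum_Hℂ_eq hU h₃ Γ₂ Γ₁ h₁ h₂]
  exact ConeChart.mulVec_mem_negCone (map_ι₁_mem_realPoints_ballDatum hU h₃ Γ₁ h₁ hγ) hv

/-- Maps of complex points of realising levels that agree on the uniformised cone agree — twisted form:
`F` over `v ↦ a v`, `q` over `v ↦ b v`, `f` over `w ↦ c w`, `b(cone₁) ⊆ cone₂`, `c ∘ b = a` on `cone₁`
`⇒ F(ℂ) = f(ℂ) ∘ q(ℂ)` (all are determined on the dense uniformised cone). [cite: BergeronMillsonMoeglin2016Balls, Part 2 §1.8] -/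
theorem mapContinuous_eq_comp_of_unif' {Γ₁ Γ₂ Γ₃ : Level V} (h₁ : (pmsCode L ι₁ V Γ₁).IsAnisotropic)
    (h₂ : (pmsCode L ι₁ V Γ₂).IsAnisotropic) (h₃' : (pmsCode L ι₁ V Γ₃).IsAnisotropic)
    {F : Var.scheme hU h₃ (.pms (pmsCode L ι₁ V Γ₁)) ⟶ Var.scheme hU h₃ (.pms (pmsCode L ι₁ V Γ₃))}
    {q : Var.scheme hU h₃ (.pms (pmsCode L ι₁ V Γ₁)) ⟶ Var.scheme hU h₃ (.pms (pmsCode L ι₁ V Γ₂))}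
    {f : Var.scheme hU h₃ (.pms (pmsCode L ι₁ V Γ₂)) ⟶ Var.scheme hU h₃ (.pms (pmsCode L ι₁ V Γ₃))}
    {a b c : (Fin 3 → ℂ) → (Fin 3 → ℂ)}
    (hF : ∀ v ∈ (Var.ballDatum hU h₃ (pmsCode L ι₁ V Γ₁) h₁).cone,
      AlgPoints.map F ((Var.ballDatum hU h₃ (pmsCode L ι₁ V Γ₁) h₁).unif v) =
        (Var.ballDatum hU h₃ (pmsCode L ι₁ V Γ₃) h₃').unif (a v))
    (hq : ∀ v ∈ (Var.ballDatum hU h₃ (pmsCode L ι₁ V Γ₁) h₁).cone,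
      AlgPoints.map q ((Var.ballDatum hU h₃ (pmsCode L ι₁ V Γ₁) h₁).unif v) =
        (Var.ballDatum hU h₃ (pmsCode L ι₁ V Γ₂) h₂).unif (b v))
    (hf : ∀ w ∈ (Var.ballDatum hU h₃ (pmsCode L ι₁ V Γ₂) h₂).cone,
      AlgPoints.map f ((Var.ballDatum hU h₃ (pmsCode L ι₁ V Γ₂) h₂).unif w) =
        (Var.ballDatum hU h₃ (pmsCode L ι₁ V Γ₃) h₃').unif (c w))
    (hb : ∀ v ∈ (Var.ballDatum hU h₃ (pmsCode L ι₁ V Γ₁) h₁).cone,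
      b v ∈ (Var.ballDatum hU h₃ (pmsCode L ι₁ V Γ₂) h₂).cone)
    (habc : ∀ v ∈ (Var.ballDatum hU h₃ (pmsCode L ι₁ V Γ₁) h₁).cone, c (b v) = a v) :
    AlgPoints.mapContinuous (L := ℂ) F =
      (AlgPoints.mapContinuous (L := ℂ) f).comp (AlgPoints.mapContinuous (L := ℂ) q) := by
  refine ContinuousMap.ext fun P => ?_
  obtain ⟨v, hv, rfl⟩ := (Var.ballDatum hU h₃ (pmsCode L ι₁ V Γ₁) h₁).surjOn_unif (Set.mem_univ P)
  rw [ContinuousMap.comp_apply, AlgPoints.mapContinuous_apply, AlgPoints.mapContinuous_apply,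
    AlgPoints.mapContinuous_apply, hF v hv, hq v hv, hf _ (hb v hv), habc v hv]

/-- **(t) in kernel: the transpose of the Hecke operator of `γ` is the Hecke operator of `γ⁻¹`.**  Given Hecke
pairs `(f₁, g)` over `Γ_γ = Γ ∩ γ⁻¹Γγ` (for `γ`) and `(f₁', g')` over `Γ_{γ⁻¹} = Γ ∩ γΓγ⁻¹` (for `γ⁻¹`), all four
maps finite coverings on complex points with the displayed behaviour on the uniformised cone, one has
`τ'_g ∘ f₁^* = τ'_{f₁'} ∘ g'^*` on `Hⁿ(X_Γ(ℂ); R)`: the Hecke translate `φ : X_{Γ_γ} → X_{Γ_{γ⁻¹}}`, `[v] ↦ [γv]`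
(`exists_heckeTranslate`, over `Level.map_conj_heckePair_Γ_le_heckePair_inv`) satisfies `g = f₁' ∘ φ` and
`f₁ = g' ∘ φ` on complex points (both sides agree on the cone), and `τ'_{f₁'∘φ} ∘ (g'∘φ)^* = τ'_{f₁'} ∘ g'^*`
(`transferMap_comp_map_eq_of_comp`).  This is the geometric form of `ᵗ(Γ γ Γ) = Γ γ⁻¹ Γ`.
[cite: Shimura1971, §3.1 Prop. 3.1, §3.2–3.4 and §7.2–7.3] [cite: HatcherAT2002, §3.G p. 321] -/
theorem transferMap_comp_pull_eq_of_heckePair_inv (hHD : exists_isReal_hodgeModel) (Γ : Level V)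
    (h : (pmsCode L ι₁ V Γ).IsAnisotropic) {γ : GL (Fin 3) L} (hγ : γ ∈ unitaryGroup (cmConjRingHom L) V.Hm)
    (hγ' : γ⁻¹ ∈ unitaryGroup (cmConjRingHom L) V.Hm)
    {f₁ g : Var.scheme hU h₃ (.pms (pmsCode L ι₁ V (Γ.heckePair γ hγ))) ⟶ Var.scheme hU h₃ (.pms (pmsCode L ι₁ V Γ))}
    {f₁' g' : Var.scheme hU h₃ (.pms (pmsCode L ι₁ V (Γ.heckePair γ⁻¹ hγ'))) ⟶
      Var.scheme hU h₃ (.pms (pmsCode L ι₁ V Γ))}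
    (cg : IsFiniteCover (AlgPoints.mapContinuous (L := ℂ) g))
    (cf' : IsFiniteCover (AlgPoints.mapContinuous (L := ℂ) f₁'))
    (hf₁ : ∀ v ∈ (Var.ballDatum hU h₃ (pmsCode L ι₁ V (Γ.heckePair γ hγ))
        ((isAnisotropic_pmsCode_iff_of_level Γ (Γ.heckePair γ hγ)).2 h)).cone,
      AlgPoints.map f₁ ((Var.ballDatum hU h₃ (pmsCode L ι₁ V (Γ.heckePair γ hγ))
        ((isAnisotropic_pmsCode_iff_of_level Γ (Γ.heckePair γ hγ)).2 h)).unif v) =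
        (Var.ballDatum hU h₃ (pmsCode L ι₁ V Γ) h).unif v)
    (hg : ∀ v ∈ (Var.ballDatum hU h₃ (pmsCode L ι₁ V (Γ.heckePair γ hγ))
        ((isAnisotropic_pmsCode_iff_of_level Γ (Γ.heckePair γ hγ)).2 h)).cone,
      AlgPoints.map g ((Var.ballDatum hU h₃ (pmsCode L ι₁ V (Γ.heckePair γ hγ))
        ((isAnisotropic_pmsCode_iff_of_level Γ (Γ.heckePair γ hγ)).2 h)).unif v) =
        (Var.ballDatum hU h₃ (pmsCode L ι₁ V Γ) h).unif (((γ : Matrix (Fin 3) (Fin 3) L).map ι₁) *ᵥ v))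
    (hf₁' : ∀ w ∈ (Var.ballDatum hU h₃ (pmsCode L ι₁ V (Γ.heckePair γ⁻¹ hγ'))
        ((isAnisotropic_pmsCode_iff_of_level Γ (Γ.heckePair γ⁻¹ hγ')).2 h)).cone,
      AlgPoints.map f₁' ((Var.ballDatum hU h₃ (pmsCode L ι₁ V (Γ.heckePair γ⁻¹ hγ'))
        ((isAnisotropic_pmsCode_iff_of_level Γ (Γ.heckePair γ⁻¹ hγ')).2 h)).unif w) =
        (Var.ballDatum hU h₃ (pmsCode L ι₁ V Γ) h).unif w)
    (hg' : ∀ w ∈ (Var.ballDatum hU h₃ (pmsCode L ι₁ V (Γ.heckePair γ⁻¹ hγ'))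
        ((isAnisotropic_pmsCode_iff_of_level Γ (Γ.heckePair γ⁻¹ hγ')).2 h)).cone,
      AlgPoints.map g' ((Var.ballDatum hU h₃ (pmsCode L ι₁ V (Γ.heckePair γ⁻¹ hγ'))
        ((isAnisotropic_pmsCode_iff_of_level Γ (Γ.heckePair γ⁻¹ hγ')).2 h)).unif w) =
        (Var.ballDatum hU h₃ (pmsCode L ι₁ V Γ) h).unif
          ((((γ⁻¹ : GL (Fin 3) L) : Matrix (Fin 3) (Fin 3) L).map ι₁) *ᵥ w))
    (n : ℕ) :
    (cg.transferMap (R := ℚ) n).hom ∘ₗ BettiUniverse.pull f₁ n =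
      (cf'.transferMap (R := ℚ) n).hom ∘ₗ BettiUniverse.pull g' n := by
  have h₁ := (isAnisotropic_pmsCode_iff_of_level Γ (Γ.heckePair γ hγ)).2 h
  have h₂ := (isAnisotropic_pmsCode_iff_of_level Γ (Γ.heckePair γ⁻¹ hγ')).2 h
  -- the Hecke translate `φ : X_{Γ_γ} → X_{Γ_{γ⁻¹}}` over `v ↦ γ v`, a finite covering
  obtain ⟨φ, cφ, hφ⟩ := exists_heckeTranslate_isFiniteCover (hU := hU) (h₃ := h₃) hHD hγ
    (Level.map_conj_heckePair_Γ_le_heckePair_inv Γ hγ) h₁ h₂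
  haveI := connectedSpace_complexPoints
    (Var.isSmoothProjective hU h₃ (.pms (pmsCode L ι₁ V (Γ.heckePair γ⁻¹ hγ'))))
  -- `g = f₁' ∘ φ` and `f₁ = g' ∘ φ` on complex points
  have hA : AlgPoints.mapContinuous (L := ℂ) g =
      (AlgPoints.mapContinuous (L := ℂ) f₁').comp (AlgPoints.mapContinuous (L := ℂ) φ) :=
    mapContinuous_eq_comp_of_unif' h₁ h₂ h hg hφ hf₁'
      (fun v hv => map_mulVec_mem_cone h₁ h₂ hγ hv) (fun v _ => rfl)
  have hB : AlgPoints.mapContinuous (L := ℂ) f₁ =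
      (AlgPoints.mapContinuous (L := ℂ) g').comp (AlgPoints.mapContinuous (L := ℂ) φ) :=
    mapContinuous_eq_comp_of_unif' h₁ h₂ h hf₁ hφ hg'
      (fun v hv => map_mulVec_mem_cone h₁ h₂ hγ hv) (fun v _ => map_inv_mulVec_map_mulVec γ v)
  exact IsFiniteCover.transferMap_comp_map_eq_of_comp cg cf' cφ hA hB n

end TransposeSwap

/-! ## §3 The Hecke algebra of an inverse-closed commuting family is semisimple ((ℓ) and (t) discharged) -/

section HeckeFamily

variable {hU : BallQuotientUniformisedDatum} {h₃ : CMAbelianVarietyRealised}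
variable {L : CMField} {ι₁ : L →+* ℂ} {V : HermSpace3 L ι₁}

/-- **The Hecke ALGEBRA on `H¹(X_Γ(ℂ); ℚ)` is semisimple element-wise, given (c) only.**  For a torsion-free level `Γ` of an
anisotropic hermitian `3`-space there are families `T, T' : U(V₃,h)(L) → End_ℚ H¹(X_Γ(ℂ); ℚ)` such that, for every `γ`,
`T_γ = τ'_{f₁} ∘ g^*` and `T'_γ = τ'_g ∘ f₁^*` for the Hecke pair `(f₁, g) : X_{Γ ∩ γ⁻¹Γγ} ⇉ X_Γ` (`f₁` over `v ↦ v`, `g` over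
`v ↦ γ^{ι₁} v`, both finite coverings on complex points); every `T_γ` is a HODGE endomorphism of the weight-one Hodge structure
of record; **`T'_γ = T_{γ⁻¹}`** (§2); and for EVERY set `S` of rational isometries closed under `γ ↦ γ⁻¹` whose operators
pairwise COMMUTE, **every element of the algebra `ℚ[T_γ : γ ∈ S]` is a semisimple endomorphism of `H¹(X_Γ(ℂ); ℚ)`**.  Proof:
the cover-stable Kähler–rational datum `D` of `X_Γ` (`exists_kaehlerRationalDatum_pull_levelCover_eq_pull_heckeTranslate`,
(ℓ)) makes a non-zero rational multiple of `T'_γ` the `Q_D`-adjoint of `T_γ` (`KaehlerRationalDatum.exists_isAdjointPair_form_one`);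
with `T'_γ = T_{γ⁻¹} ∈ ℚ[T_S]` the family is adjoint-stable and `Polarization.isSemisimple_of_mem_adjoin` applies.  Displayed
hypothesis: (c) (commutativity — printed for the spherical Hecke algebra).
[cite: Shimura1971, §3.1 Prop. 3.1, §3.2–3.4 and §7.2–7.3] [cite: Lange2023AbelianVarietiesC, §2.4.1 Thm. 2.4.9]
[cite: VoisinHodgeI2002, §7.1.2] [cite: HatcherAT2002, §3.G p. 321] -/
theorem exists_heckeAlgebra_isSemisimple_of_inv_mem (hHD : exists_isReal_hodgeModel)
    (hI : hodgePQ_independent_of_hodgeModel) (Γ : Level V) (h : (pmsCode L ι₁ V Γ).IsAnisotropic) :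
    ∃ T T' : ↥(unitaryGroup (cmConjRingHom L) V.Hm) →
        Module.End ℚ (bettiCohomology (Var.scheme hU h₃ (.pms (pmsCode L ι₁ V Γ))) 1),
      (∀ γ : ↥(unitaryGroup (cmConjRingHom L) V.Hm),
        ∃ (f₁ g : Var.scheme hU h₃ (.pms (pmsCode L ι₁ V (Γ.heckePair (γ : GL (Fin 3) L) γ.2))) ⟶
            Var.scheme hU h₃ (.pms (pmsCode L ι₁ V Γ)))
          (c₁ : IsFiniteCover (AlgPoints.mapContinuous (L := ℂ) f₁))
          (c₂ : IsFiniteCover (AlgPoints.mapContinuous (L := ℂ) g)),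
          (∀ v ∈ (Var.ballDatum hU h₃ (pmsCode L ι₁ V (Γ.heckePair (γ : GL (Fin 3) L) γ.2))
              ((isAnisotropic_pmsCode_iff_of_level Γ (Γ.heckePair (γ : GL (Fin 3) L) γ.2)).2 h)).cone,
            AlgPoints.map f₁ ((Var.ballDatum hU h₃ (pmsCode L ι₁ V (Γ.heckePair (γ : GL (Fin 3) L) γ.2))
              ((isAnisotropic_pmsCode_iff_of_level Γ (Γ.heckePair (γ : GL (Fin 3) L) γ.2)).2 h)).unif v) =
              (Var.ballDatum hU h₃ (pmsCode L ι₁ V Γ) h).unif v) ∧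
          (∀ v ∈ (Var.ballDatum hU h₃ (pmsCode L ι₁ V (Γ.heckePair (γ : GL (Fin 3) L) γ.2))
              ((isAnisotropic_pmsCode_iff_of_level Γ (Γ.heckePair (γ : GL (Fin 3) L) γ.2)).2 h)).cone,
            AlgPoints.map g ((Var.ballDatum hU h₃ (pmsCode L ι₁ V (Γ.heckePair (γ : GL (Fin 3) L) γ.2))
              ((isAnisotropic_pmsCode_iff_of_level Γ (Γ.heckePair (γ : GL (Fin 3) L) γ.2)).2 h)).unif v) =
              (Var.ballDatum hU h₃ (pmsCode L ι₁ V Γ) h).unif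
                ((((γ : GL (Fin 3) L) : Matrix (Fin 3) (Fin 3) L).map ι₁) *ᵥ v)) ∧
          T γ = (c₁.transferMap (R := ℚ) 1).hom ∘ₗ BettiUniverse.pull g 1 ∧
          T' γ = (c₂.transferMap (R := ℚ) 1).hom ∘ₗ BettiUniverse.pull f₁ 1) ∧
      (∀ γ, T γ ∈ (BettiUniverse.hodge hHD (Var.isSmoothProjective hU h₃ (.pms (pmsCode L ι₁ V Γ))) 1).endAlg) ∧
      (∀ γ, T' γ = T γ⁻¹) ∧
      ∀ S : Set ↥(unitaryGroup (cmConjRingHom L) V.Hm), (∀ γ ∈ S, γ⁻¹ ∈ S) →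
        (∀ γ ∈ S, ∀ δ ∈ S, Commute (T γ) (T δ)) →
        ∀ a ∈ Algebra.adjoin ℚ (Set.range fun δ : S => T δ), Module.End.IsSemisimple a := by
  classical
  obtain ⟨D, hD⟩ := exists_kaehlerRationalDatum_pull_levelCover_eq_pull_heckeTranslate (hU := hU) (h₃ := h₃) Γ h
  have hX := Var.isSmoothProjective hU h₃ (.pms (pmsCode L ι₁ V Γ))
  have key : ∀ γ : ↥(unitaryGroup (cmConjRingHom L) V.Hm),
      ∃ (f₁ g : Var.scheme hU h₃ (.pms (pmsCode L ι₁ V (Γ.heckePair (γ : GL (Fin 3) L) γ.2))) ⟶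
          Var.scheme hU h₃ (.pms (pmsCode L ι₁ V Γ)))
        (c₁ : IsFiniteCover (AlgPoints.mapContinuous (L := ℂ) f₁))
        (c₂ : IsFiniteCover (AlgPoints.mapContinuous (L := ℂ) g)),
        (∀ v ∈ (Var.ballDatum hU h₃ (pmsCode L ι₁ V (Γ.heckePair (γ : GL (Fin 3) L) γ.2))
            ((isAnisotropic_pmsCode_iff_of_level Γ (Γ.heckePair (γ : GL (Fin 3) L) γ.2)).2 h)).cone,
          AlgPoints.map f₁ ((Var.ballDatum hU h₃ (pmsCode L ι₁ V (Γ.heckePair (γ : GL (Fin 3) L) γ.2))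
            ((isAnisotropic_pmsCode_iff_of_level Γ (Γ.heckePair (γ : GL (Fin 3) L) γ.2)).2 h)).unif v) =
            (Var.ballDatum hU h₃ (pmsCode L ι₁ V Γ) h).unif v) ∧
        (∀ v ∈ (Var.ballDatum hU h₃ (pmsCode L ι₁ V (Γ.heckePair (γ : GL (Fin 3) L) γ.2))
            ((isAnisotropic_pmsCode_iff_of_level Γ (Γ.heckePair (γ : GL (Fin 3) L) γ.2)).2 h)).cone,
          AlgPoints.map g ((Var.ballDatum hU h₃ (pmsCode L ι₁ V (Γ.heckePair (γ : GL (Fin 3) L) γ.2))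
            ((isAnisotropic_pmsCode_iff_of_level Γ (Γ.heckePair (γ : GL (Fin 3) L) γ.2)).2 h)).unif v) =
            (Var.ballDatum hU h₃ (pmsCode L ι₁ V Γ) h).unif
              ((((γ : GL (Fin 3) L) : Matrix (Fin 3) (Fin 3) L).map ι₁) *ᵥ v)) ∧
        (c₁.transferMap (R := ℚ) 1).hom ∘ₗ BettiUniverse.pull g 1 ∈ (BettiUniverse.hodge hHD hX 1).endAlg ∧
        ∃ r : ℚ, r ≠ 0 ∧ LinearMap.IsAdjointPair (D.form hX 1) (D.form hX 1)
          ((c₁.transferMap (R := ℚ) 1).hom ∘ₗ BettiUniverse.pull g 1)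
          (r • ((c₂.transferMap (R := ℚ) 1).hom ∘ₗ BettiUniverse.pull f₁ 1)) := by
    intro γ
    obtain ⟨f₁, g, c₁, c₂, hf₁, hg, hT, -⟩ := exists_heckeOperator_isSemisimple_one'' (hU := hU) (h₃ := h₃) hHD hI
      (Level.heckePair_Γ_le Γ γ.2) h
      ((isAnisotropic_pmsCode_iff_of_level Γ (Γ.heckePair (γ : GL (Fin 3) L) γ.2)).2 h) γ.2
      (Level.map_conj_heckePair_Γ_le Γ γ.2)
    obtain ⟨r, hr, hadj⟩ := D.exists_isAdjointPair_form_one hX c₁ c₂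
      (finrank_rat_top (Var.isSmoothProjective hU h₃
        (.pms (pmsCode L ι₁ V (Γ.heckePair (γ : GL (Fin 3) L) γ.2)))))
      (hD _ _ f₁ g γ γ.2 (Level.heckePair_Γ_le Γ γ.2) (Level.map_conj_heckePair_Γ_le Γ γ.2) hf₁ hg)
    exact ⟨f₁, g, c₁, c₂, hf₁, hg, hT, r, hr, hadj⟩
  choose f₁ g c₁ c₂ hf₁ hg hT r hr hadj using key
  have ht : ∀ γ : ↥(unitaryGroup (cmConjRingHom L) V.Hm),
      ((c₂ γ).transferMap (R := ℚ) 1).hom ∘ₗ BettiUniverse.pull (f₁ γ) 1 =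
        ((c₁ γ⁻¹).transferMap (R := ℚ) 1).hom ∘ₗ BettiUniverse.pull (g γ⁻¹) 1 := fun γ =>
    transferMap_comp_pull_eq_of_heckePair_inv (hU := hU) (h₃ := h₃) hHD Γ h γ.2 (γ⁻¹).2 (c₂ γ) (c₁ γ⁻¹)
      (hf₁ γ) (hg γ) (hf₁ γ⁻¹) (hg γ⁻¹) 1
  refine ⟨fun γ => ((c₁ γ).transferMap (R := ℚ) 1).hom ∘ₗ BettiUniverse.pull (g γ) 1,
    fun γ => ((c₂ γ).transferMap (R := ℚ) 1).hom ∘ₗ BettiUniverse.pull (f₁ γ) 1,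
    fun γ => ⟨f₁ γ, g γ, c₁ γ, c₂ γ, hf₁ γ, hg γ, rfl, rfl⟩, hT, ht, fun S hS hcomm a ha => ?_⟩
  haveI := BettiUniverse.finite hX 1
  refine (D.polarization hX (BettiUniverse.realHodgeModel hHD hX)
    (BettiUniverse.realHodgeModel_isHodgeSymmetric hHD hX) 1).isSemisimple_of_mem_adjoin
    (fun δ : S => ((c₁ δ).transferMap (R := ℚ) 1).hom ∘ₗ BettiUniverse.pull (g δ) 1)
    (fun δ => hT δ) (fun δ ε => hcomm δ δ.2 ε ε.2) (fun δ => ?_) ha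
  refine ⟨r δ • (((c₂ δ).transferMap (R := ℚ) 1).hom ∘ₗ BettiUniverse.pull (f₁ δ) 1),
    Subalgebra.smul_mem _ ?_ _, hadj δ⟩
  rw [ht δ]
  exact Algebra.subset_adjoin ⟨⟨(δ : ↥(unitaryGroup (cmConjRingHom L) V.Hm))⁻¹, hS δ δ.2⟩, rfl⟩

end HeckeFamily

end Model

end Summit.HodgeConjecture.CorCM

end
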